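import Literature.AnabelianGeometry.SemiGraphs.TemperedEdgeLikeInfOfHosts
import Literature.AnabelianGeometry.SemiGraphs.TemperedPiEdgeGroupsInfVerticial
import Literature.AnabelianGeometry.SemiGraphs.TemperedPiPresentationInputs
import Literature.AnabelianGeometry.SemiGraphs.TemperedChartTransport
import Literature.AnabelianGeometry.SemiGraphs.TreeSystemFixedClosedEdges
import HarnessLib

/-!
# [SemiAnbd] Thm 3.7 (iv) p. 41, clause 2 — the named residual `EdgeLikeIsInfVerticial` HOLDS
# (FACT-LIST F-1703), unconditionally, from the tower of trees

Mochizuki, *Semi-graphs of anabelioids*, Publ. RIMS **42** (2006) [MochizukiSemiAnbd2006], Thm. 3.7 (iv)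
p. 41: "The nontrivial intersections of two distinct maximal compact subgroups of `π₁^temp(𝒢)` are
precisely the edge-like subgroups" — print mechanism (proof of Thm. 3.7 (iii), p. 41): on the trees
`𝒢_{∞,i}` the decomposition group of a closed edge is the intersection of the decomposition groups of
its two (distinct) end-vertices. [cite: MochizukiSemiAnbd2006, Thm 3.7(iv) p.41]

PROOF-ONLY companion of `TemperedMaximalCompact.lean` (abc-iut-L3-t11, p407451), which types the residual
`ProfiniteSemiGraph.EdgeLikeIsInfVerticial` (every nontrivial edge-like subgroup of a CLOSED edge is
`H₁ ⊓ H₂` for two DISTINCT verticial subgroups) and reduces Thm. 3.7 (iv) to Thm. 3.7 (ii), (iii) and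
this residual (`MaximalCompactIffVerticial_of`).  The tree so far discharged the residual only THROUGH
Thm. 3.7 (iii) (`edgeLikeIsInfVerticial_of`, `edgeLikeIsInfVerticial_of_compactInVerticial`).  This file
proves it WITHOUT (iii), for every `𝒢` satisfying the hypotheses of Thm. 3.7 and every chart
(abc-iut cell, block F fact-proving wave, seat abc-iut-f-173; FACT-LIST row F-1703):

* at the constructed chart `𝒢.temperedPiChart h36` ([SemiAnbd] Prop. 3.6 (i)(ii), abc-iut-L3-t9) take
  abc-iut-L3-d4's presentation `P := D.piPresentation T R` of `𝔾` in `π₁^temp(𝒢)` (compatible point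
  sequences `T` over every vertex — `GaloisLevelData.nonempty_pointSeq_family`; reference branches `R` —
  `SemiGraph.nonempty_refBranches_of_isConnected`: in a connected semi-graph with a vertex every edge has
  an abutting branch); its vertex groups `H_w` are verticial, its edge groups `M_e` edge-like
  (`piPresentation_M_mem_edgeLikeSubgroups_temperedPiChart`), so an edge-like `L` of `e` is a conjugate `k M_e k⁻¹` (one
  conjugacy class per edge, Prop. 3.2);
* abc-iut-w4-d085's `GaloisLevelData.piPresentation_hEI` (p428788; the trees `𝒢_{∞,n}` have no double
  edges) is the subgroup identity `M_e = s_b⁻¹ H_w s_b ⊓ s_{b'}⁻¹ H_{w'} s_{b'}` for the two branches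
  `b ≠ b'` of the closed edge `e` (`piPresentation_M_eq_inf`);
* the two positioned hosts are DISTINCT (abc-iut-w4-d082's `map_conj_inv_s_ne_of_ne`, p430702: Thm. 3.7
  (ii) `verticialDistinct_holds` for `w ≠ w'`; for a loop the no-loop input `s_{b'} s_b⁻¹ ∉ H_w`, which
  is `piPresentation_vMk_s_mul_ne` — the two ends of an edge of the tree `𝒢_{∞,0}` are distinct —
  read through `vMk_eq_vMk_iff`: `piPresentation_s_mul_s_inv_not_mem`);
* conjugating by `k` and transporting along the compatible isomorphism of charts
  (`TemperedPiChart.exists_compatIso`, `mem_verticialSubgroups_map`, `mem_edgeLikeSubgroups_map`, Prop. 3.2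
  / Rmk. 3.2.1) gives the statement at every chart: `edgeLikeIsInfVerticialAt_holds`,
  **`edgeLikeIsInfVerticial_holds`** (the hypothesis `L ≠ ⊥` of the typed residual is not used).

Consequence: in `MaximalCompactIffVerticial_of` / `maximalCompactIffVerticialAt_of` (Thm. 3.7 (iv)) the
argument `hE` is now a theorem (the tree's `maximalCompactIffVerticial_of_compactInVerticial` already has
the dependence on (iii) alone, routing the residual THROUGH (iii)).  No definition; no statement of the paper is
strengthened; nothing here bears on [IUTchIII] Cor. 3.12; typed ≠ proved elsewhere.
-/

namespace Literature.AnabelianGeometry.SemiGraphs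

open CategoryTheory
open scoped Pointwise

universe u

/-! ### Reference branches of a connected semi-graph with a vertex -/

namespace SemiGraph

/-- **Reference branches exist for a connected semi-graph with a vertex** ([SemiAnbd] §1 p. 11): every
edge has a branch abutting to some vertex (`exists_abuts_of_isConnected`), so the datum `R : RefBranches 𝔾`
of abc-iut-L3-d4's `piPresentation` exists (companion of `nonempty_refBranches_of_isGraph` for semi-graphs
with open edges). [cite: MochizukiSemiAnbd2006, §1 p.11] -/
theorem nonempty_refBranches_of_isConnected (𝔾 : SemiGraph.{u}) (hG : 𝔾.IsConnected)
    (v₀ : 𝔾.Vertex) : Nonempty (RefBranches 𝔾) := by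
  classical
  have hβ : ∀ e : 𝔾.Edge, ∃ (b : 𝔾.Branch) (v : 𝔾.Vertex), 𝔾.edgeOf b = e ∧ 𝔾.abuts b = some v :=
    fun e => by
      obtain ⟨b, hbe, hb⟩ := exists_abuts_of_isConnected hG v₀ e
      obtain ⟨v, hv⟩ := Option.isSome_iff_exists.mp hb
      exact ⟨b, v, hbe, hv⟩
  choose β ν hβe hνe using hβ
  exact ⟨{ β := β, edgeOf_β := hβe, ν := ν, abuts_β := hνe }⟩

end SemiGraph

namespace ProfiniteSemiGraph

variable {𝒢 : ProfiniteSemiGraph.{u}}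

/-! ### At the presentation of `𝔾` in `π₁^temp(𝒢)`: the no-loop input and `M_e` as a meet -/

section PiPresentation

variable (h36 : 𝒢.Prop36Hypotheses)
  (T : ∀ w : 𝒢.graph.Vertex, (𝒢.galoisLevelData h36).PointSeq h36.isCountable w)
  (R : SemiGraph.RefBranches 𝒢.graph)

/-- The edge groups `M_e = (T (ν e)).decompHom (Π_{β e})` of the presentation are edge-like at `e`: the
image of the edge homomorphism `decompHom ∘ (β e)_*` (abc-iut-L3-t8's `isEdgeHom_comp_brHom`).  (Same
statement as abc-iut-w4-d082's `piPresentation_M_mem_edgeLikeSubgroups` of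
`ArithPiPresentationOuterCompat.lean`, re-derived here to keep this file's imports inside §3.)
[cite: MochizukiSemiAnbd2006, Thm 3.7(iii) p.41] -/
theorem piPresentation_M_mem_edgeLikeSubgroups_temperedPiChart (e : 𝒢.graph.Edge) :
    ((𝒢.galoisLevelData h36).piPresentation h36.isCountable T R).M e ∈
      edgeLikeSubgroups (𝒢.temperedPiChart h36) e := by
  have hmem : ((𝒢.branchSubgroup (R.β e) (R.ν e) (R.abuts_β e)).map (T (R.ν e)).decompHom) ∈
      edgeLikeSubgroups (𝒢.temperedPiChart h36) (𝒢.graph.edgeOf (R.β e)) :=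
    ⟨(T (R.ν e)).decompHomCont.comp (𝒢.brHom (R.β e) (R.ν e) (R.abuts_β e)),
      isEdgeHom_comp_brHom _ (R.abuts_β e) (T (R.ν e)).isVerticialHom_decompHomCont, by
        rw [branchSubgroup, MonoidHom.map_range]; rfl⟩
  rw [R.edgeOf_β] at hmem
  simpa only [GaloisLevelData.piPresentation_M] using hmem

/-- **The no-loop input at `π₁^temp(𝒢)`**: for two distinct branches `b ≠ b'` of one edge abutting to the
SAME vertex `w`, `s_{b'} s_b⁻¹ ∉ H_w` — otherwise the two ends `H_w s_b · ker ρ₀`, `H_w s_{b'} · ker ρ₀` of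
the edge `M_e · ker ρ₀` of the tree `𝒢_{∞,0}` would coincide (`piPresentation_vMk_s_mul_ne`: no loops in a
tree). [cite: MochizukiSemiAnbd2006, Thm 3.7(iii) p.41] -/
theorem piPresentation_s_mul_s_inv_not_mem {b b' : 𝒢.graph.Branch} {w : 𝒢.graph.Vertex} (hbb' : b ≠ b')
    (he : 𝒢.graph.edgeOf b = 𝒢.graph.edgeOf b') (hb : 𝒢.graph.abuts b = some w)
    (hb' : 𝒢.graph.abuts b' = some w) :
    ((𝒢.galoisLevelData h36).piPresentation h36.isCountable T R).s b' *
        (((𝒢.galoisLevelData h36).piPresentation h36.isCountable T R).s b)⁻¹ ∉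
      ((𝒢.galoisLevelData h36).piPresentation h36.isCountable T R).H w := by
  intro hmem
  refine GaloisLevelData.piPresentation_vMk_s_mul_ne (𝒢.galoisLevelData h36) h36.isCountable T R 0
    hbb' he hb hb' 1 ?_
  rw [SemiGraph.SubgroupPresentation.vMk_eq_vMk_iff, DoubleCoset.eq]
  exact ⟨_, hmem, 1, Subgroup.one_mem _, by group⟩

/-- **`M_e` is the meet of its two positioned vertex groups**, `M_e = s_b⁻¹ H_w s_b ⊓ s_{b'}⁻¹ H_{w'} s_{b'}`
for the two branches `b ≠ b'` of `e` abutting to `w`, `w'` — abc-iut-w4-d085's `piPresentation_hEI` (the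
trees `𝒢_{∞,n}` have no double edges) as a subgroup identity. [cite: MochizukiSemiAnbd2006, Thm 3.7(iv) p.41] -/
theorem piPresentation_M_eq_inf {b b' : 𝒢.graph.Branch} {w w' : 𝒢.graph.Vertex} (hbb' : b ≠ b')
    (he : 𝒢.graph.edgeOf b = 𝒢.graph.edgeOf b') (hb : 𝒢.graph.abuts b = some w)
    (hb' : 𝒢.graph.abuts b' = some w') :
    ((𝒢.galoisLevelData h36).piPresentation h36.isCountable T R).M (𝒢.graph.edgeOf b) =
      (((𝒢.galoisLevelData h36).piPresentation h36.isCountable T R).H w).map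
          (MulAut.conj (((𝒢.galoisLevelData h36).piPresentation h36.isCountable T R).s b)⁻¹).toMonoidHom ⊓
        (((𝒢.galoisLevelData h36).piPresentation h36.isCountable T R).H w').map
          (MulAut.conj (((𝒢.galoisLevelData h36).piPresentation h36.isCountable T R).s b')⁻¹).toMonoidHom := by
  ext x
  rw [Subgroup.mem_inf, mem_map_conj_inv_iff, mem_map_conj_inv_iff]
  exact GaloisLevelData.piPresentation_hEI (𝒢.galoisLevelData h36) h36.isCountable T R b b' w w' hbb' he
    hb hb' x

end PiPresentation

/-! ### Thm 3.7 (iv) clause 2 at the constructed chart -/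

/-- **At the constructed chart `𝒢.temperedPiChart h36`**: every edge-like subgroup `L` of a CLOSED edge
`e` is `H₁ ⊓ H₂` for two DISTINCT verticial subgroups `H₁`, `H₂` (at the two end-vertices of `e`) — `L`
is a conjugate `k M_e k⁻¹` of the presentation's edge group (one conjugacy class per edge), `M_e` is the
meet of its two positioned hosts, which are verticial and distinct. [cite: MochizukiSemiAnbd2006, Thm 3.7(iv) p.41] -/
theorem exists_verticial_ne_inf_eq_temperedPiChart (h37 : 𝒢.Thm37Hypotheses) {e : 𝒢.graph.Edge}
    (he : 𝒢.graph.IsClosedEdge e)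
    {L : Subgroup (𝒢.temperedPiChart h37.toProp36Hypotheses).G}
    (hL : L ∈ edgeLikeSubgroups (𝒢.temperedPiChart h37.toProp36Hypotheses) e) :
    ∃ (v₁ v₂ : 𝒢.graph.Vertex) (H₁ H₂ : Subgroup (𝒢.temperedPiChart h37.toProp36Hypotheses).G),
      H₁ ∈ verticialSubgroups (𝒢.temperedPiChart h37.toProp36Hypotheses) v₁ ∧
        H₂ ∈ verticialSubgroups (𝒢.temperedPiChart h37.toProp36Hypotheses) v₂ ∧ H₁ ≠ H₂ ∧
          L = H₁ ⊓ H₂ := by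
  obtain ⟨T⟩ := GaloisLevelData.nonempty_pointSeq_family h37.toProp36Hypotheses
  obtain ⟨R⟩ := SemiGraph.nonempty_refBranches_of_isConnected 𝒢.graph h37.isConnected
    (𝒢.baseVertex h37.toProp36Hypotheses)
  -- the two branches of the closed edge
  obtain ⟨b, b', w, w', hbb', hbe, hb'e, hb, hb'⟩ := SemiGraph.exists_branches_of_isClosedEdge he
  subst hbe
  have hPH : ∀ v, ((𝒢.galoisLevelData h37.toProp36Hypotheses).piPresentation
      h37.toProp36Hypotheses.isCountable T R).H v ∈
        verticialSubgroups (𝒢.temperedPiChart h37.toProp36Hypotheses) v :=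
    fun v => (T v).range_decompHom_mem_verticialSubgroups
  -- `L = k M_e k⁻¹`
  obtain ⟨k, rfl⟩ := exists_conj_of_mem_edgeLikeSubgroups (𝒢.temperedPiChart h37.toProp36Hypotheses)
    (piPresentation_M_mem_edgeLikeSubgroups_temperedPiChart h37.toProp36Hypotheses T R
      (𝒢.graph.edgeOf b)) hL
  -- the two positioned hosts: verticial, distinct, meeting in `M_e`
  have hK₁ := conj_mem_verticialSubgroups (𝒢.temperedPiChart h37.toProp36Hypotheses) (hPH w)
    (((𝒢.galoisLevelData h37.toProp36Hypotheses).piPresentation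
      h37.toProp36Hypotheses.isCountable T R).s b)⁻¹
  have hK₂ := conj_mem_verticialSubgroups (𝒢.temperedPiChart h37.toProp36Hypotheses) (hPH w')
    (((𝒢.galoisLevelData h37.toProp36Hypotheses).piPresentation
      h37.toProp36Hypotheses.isCountable T R).s b')⁻¹
  have hne := ((𝒢.galoisLevelData h37.toProp36Hypotheses).piPresentation
      h37.toProp36Hypotheses.isCountable T R).map_conj_inv_s_ne_of_ne
    (𝒢.temperedPiChart h37.toProp36Hypotheses) h37 hPH
    (fun c c' v hcc' hce hc hc' =>
      piPresentation_s_mul_s_inv_not_mem h37.toProp36Hypotheses T R hcc' hce hc hc')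
    hbb' hb'e.symm hb hb'
  have hM := piPresentation_M_eq_inf h37.toProp36Hypotheses T R hbb' hb'e.symm hb hb'
  have hinj : Function.Injective
      (MulAut.conj k : MulAut (𝒢.temperedPiChart h37.toProp36Hypotheses).G).toMonoidHom :=
    (MulAut.conj k).injective
  refine ⟨w, w', _, _, conj_mem_verticialSubgroups _ hK₁ k, conj_mem_verticialSubgroups _ hK₂ k,
    fun h => hne (Subgroup.map_injective hinj h), ?_⟩
  rw [hM]
  -- the meet is taken in `Subgroup (π₁^temp(𝒢))`; `conj k` is injective
  ext y
  constructor
  · rintro ⟨x, hx, rfl⟩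
    exact ⟨⟨x, (Subgroup.mem_inf.mp hx).1, rfl⟩, ⟨x, (Subgroup.mem_inf.mp hx).2, rfl⟩⟩
  · rintro ⟨⟨x₁, hx₁, hx₁y⟩, ⟨x₂, hx₂, rfl⟩⟩
    obtain rfl : x₁ = x₂ := hinj hx₁y
    exact ⟨x₁, Subgroup.mem_inf.mpr ⟨hx₁, hx₂⟩, rfl⟩

/-! ### Every chart: the At-form and the frozen fact -/

/-- **[SemiAnbd] Thm 3.7 (iv) clause 2 AT every `𝒢`** (`EdgeLikeIsInfVerticialAt 𝒢`), for EVERY chart: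
transport from the constructed chart along the compatible isomorphism of charts (Prop. 3.2 / Rmk. 3.2.1,
`TemperedPiChart.exists_compatIso`). [cite: MochizukiSemiAnbd2006, Thm 3.7(iv) p.41] -/
theorem edgeLikeIsInfVerticialAt_holds (𝒢 : ProfiniteSemiGraph.{u}) : EdgeLikeIsInfVerticialAt 𝒢 := by
  intro h37 c e he L hL _
  obtain ⟨φ, ψ, hψφ, hφψ, hφ, hψ⟩ :=
    TemperedPiChart.exists_compatIso (𝒢.temperedPiChart h37.toProp36Hypotheses) c
  obtain ⟨v₁, v₂, H₁, H₂, hH₁, hH₂, hne, hLeq⟩ :=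
    exists_verticial_ne_inf_eq_temperedPiChart h37 he (mem_edgeLikeSubgroups_map ψ hψ hL)
  have hφinj : Function.Injective φ.toMonoidHom :=
    (Function.LeftInverse.injective hψφ : Function.Injective φ)
  have hLback : (L.map ψ.toMonoidHom).map φ.toMonoidHom = L := by
    ext y
    constructor
    · rintro ⟨_, ⟨z, hz, rfl⟩, rfl⟩
      show φ (ψ z) ∈ L
      rw [hφψ]
      exact hz
    · intro hy
      exact ⟨ψ y, ⟨y, hy, rfl⟩, hφψ y⟩
  refine ⟨v₁, v₂, H₁.map φ.toMonoidHom, H₂.map φ.toMonoidHom, mem_verticialSubgroups_map φ hφ hH₁,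
    mem_verticialSubgroups_map φ hφ hH₂, fun h => hne (Subgroup.map_injective hφinj h), ?_⟩
  rw [← hLback, hLeq, Subgroup.map_inf _ _ _ hφinj]

/-- **FACT-LIST F-1703 — `EdgeLikeIsInfVerticial` HOLDS** ([SemiAnbd] Thm 3.7 (iv) p. 41, clause 2: every
nontrivial edge-like subgroup of a closed edge of `π₁^temp(𝒢)` is the intersection of two distinct
verticial subgroups), for every `𝒢` satisfying the hypotheses of Thm. 3.7 and every chart, from the
tower of trees; Thm. 3.7 (iii) is NOT used. [cite: MochizukiSemiAnbd2006, Thm 3.7(iv) p.41] -/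
theorem edgeLikeIsInfVerticial_holds :
    Literature.AnabelianGeometry.SemiGraphs.ProfiniteSemiGraph.EdgeLikeIsInfVerticial.{u} :=
  fun 𝒢 => edgeLikeIsInfVerticialAt_holds 𝒢

end ProfiniteSemiGraph

end Literature.AnabelianGeometry.SemiGraphs
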